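import Summits.Parity.BatemanHorn.Theorems.SoloInformedWindowRootFourier

/-!
# SoloInformedWindowRootFourierLocated — the window / located root discrepancy as an exact bilinear form in Hooley sums

Solo unit `solo-Parity-informed` (ideation tier, informed mode), session 142; `PLAN.md` §107, CLAIMS C244.
Sequel of `SoloInformedWindowRootFourier` (finite Fourier completion of the roots of `g` in an incomplete interval of `ℤ/e` by
Hooley sums `S_g(h; e) = ∑_{ν mod e, g(ν)≡0} e(hν/e)`).  Here the completion is summed over the moduli of a window past `x`:

* `polyWindowRootCount g x y₁ y₂ = #{(n, e) : 1 ≤ n ≤ x, y₁ < e ≤ y₂, e ∣ g(n)}`; for `g` without zeros in `[1, x]`: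
  `polyWindowRootCount_eq_sum_card` (Fubini) and, for `x ≤ y₁`, `polyWindowRootCount_eq_sum_card_rootResidues`
  (`= ∑_{y₁<e≤y₂} #(roots of g mod e in [1, x])` — divisors past `x` are located roots, `Icc_filter_dvd_eq_rootResidues_inter`);
* `polyWindowRootCount_sub_heuristic_eq` — the EXACT identity, for `x ≤ y₁`:
  `W_g(x; y₁, y₂) − x·∑_{y₁<e≤y₂} ρ_g(e)/e = ∑_{y₁<e≤y₂} (1/e)·∑_{0<h<e} F_{[1,x]}(h; e)·S_g(h; e)`
  (the subtracted term is `polyWindowHeuristic g x y₁ y₂` of `SoloInformedLocatedWindowMass`, `polyWindowHeuristic_eq_sum`), and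
  `abs_polyWindowRootCount_sub_heuristic_le` — the WINDOW COMPLETION INEQUALITY
  `|W − x∑ρ_g(e)/e| ≤ ∑_{y₁<e≤y₂} (1/e)·∑_{0<h<e} min(x, e/(2 min(h, e−h)))·|S_g(h; e)|`;
* the located root count itself (`n`-dependent windows): with `B_g(x; e) = {1 ≤ n ≤ x : e² < |g(n)|}` (`polyLocatedRange`) and
  the sharp heuristic `H⁻_g(x) = ∑_{n≤x} ∑_{x<e, e²<|g(n)|} ρ_g(e)/e` (`polyLocatedHeuristicSharp`; `0 ≤ H_g − H⁻_g ≤ x`,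
  `polyLocatedHeuristic_sub_sharp` — the two differ only at `e = √|g(n)|`), for every `E ≥ max_{n≤x} |g(n)|`:
  `polyLocatedRootCount_eq_sum_card` (`Mid_g(x) = ∑_{x<e≤E} #(roots mod e in B_g(x;e))`), `polyLocatedHeuristicSharp_eq_sum`,
  `polyLocatedRootCount_sub_sharp_eq` — the EXACT identity
  `Mid_g(x) − H⁻_g(x) = ∑_{x<e≤E} (1/e)·∑_{0<h<e} F_{B_g(x;e)}(h; e)·S_g(h; e)`,  `F_B(h; e) = ∑_{m∈B} e(−hm/e)`,
  and `abs_polyLocatedRootCount_sub_sharp_le`.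

So the open quantity of the `d ≥ 3` rung (`WindowRootEquidistribution g`: `Mid_g − H_g = o(x log x)`) is EXACTLY a bilinear form
in Hooley's sums over the roots of `g` to the moduli `e ∈ (x, x^{d/2+o(1)}]`, weighted by the Fourier coefficients of the sets
`B_g(x; e) ⊆ [1, x]` (upper sub-intervals `[n_e, x]` once `|g|` increases on `[1, x]`).

What this says about the rung (informal; nothing below is used in the proofs).  (1) Summed trivially (`|S_g(h;e)| ≤ ρ_g(e)`,
`∑_{0<h<e} min(x, e/(2 min(h,e−h))) ≍ e log x` for `e > x`) the right-hand side over the located window `x < e ≤ x^{d/2}` is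
`≍ (∑_{e≤x^{d/2}} ρ_g(e)) log x ≍ A_g x^{d/2} log x`, against the target `o(x log x)`; per modulus there is nothing to gain
(for a prime `e = p > x`, `|S_g(h;p)| ≤ d` and each residue class meets `[1, x]` at most once).  (2) Hence ALL the content of
`WindowRootEquidistribution g` is CANCELLATION IN THE MODULUS SUM of Hooley sums twisted by the kernel phase,
`∑_{E<e≤E'} e(−hm/e)·S_g(h; e)` (`m ≤ x < E`), saving the factor `E/x` at scale `E` — a power saving `E^θ`, `θ < 2/d` — and,
because the sharp cut-off `[1, x]` has Fourier coefficients of size `e/h` at ALL frequencies `0 < |h| < e/2`, uniformly in `h`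
in a POWER range (after smoothing the cut-off in `n` at relative width `Δ`, `|h| ≤ (E/x)²/Δ · x^{ε}`; the smoothing and the
resulting conditional implication are the next files of this series).  (3) The literature's currency is exactly these sums:
Hooley (1964) proves `∑_{e≤E} S_g(h; e) = o(E)` for each FIXED `h ≠ 0` and every irreducible `g` of degree `≥ 2`
(equidistribution of the roots `ν/e (mod 1)` on average over `e`; reproved and generalised by Kowalski–Soundararajan,
Adv. Math. 385 (2021) 107776 = arXiv:2003.12965, §2.2); for `d = 2` power savings uniform in `h` come from the Gauss
correspondence between roots of quadratic congruences and representations by binary quadratic forms (Hooley, Acta Math. 110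
(1963); Duke–Friedlander–Iwaniec, Ann. of Math. 141 (1995); Tóth, IMRN 2000) — the mechanism behind the proved `d = 2` case —
and no analogue of that parametrisation is known for `d ≥ 3`.  This is a typing of the obstruction, not progress on it; it lies
below the parity wall of `paper/SHARPEST-STATEMENT.md` §2 and has no path to `BatemanHornConjecture`.  No sorry, no new axioms.
-/

namespace Summit.Parity.BatemanHorn.Theorems

open Finset Polynomial
open Literature.NumberTheory.Sieve (polyRootCountMod)

/-! ### Windows of moduli past `x`: the discrepancy is a bilinear form in Hooley sums -/

/-- The WINDOW ROOT COUNT: the number of pairs `(n, e)` with `1 ≤ n ≤ x`, `y₁ < e ≤ y₂`, `e ∣ g(n)`, i.e. the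
divisors of the values `g(n)`, `n ≤ x`, lying in the window of moduli `(y₁, y₂]`. [this work] -/
def polyWindowRootCount (g : ℤ[X]) (x y₁ y₂ : ℕ) : ℕ :=
  ∑ n ∈ Icc 1 x, #(((g.eval (n : ℤ)).natAbs.divisors).filter fun e => y₁ < e ∧ e ≤ y₂)

/-- The divisors of `N ≠ 0` in `(y₁, y₂]` are the `e ∈ (y₁, y₂]` dividing `N`. [folklore] -/
theorem divisors_filter_window_eq_Ioc_filter {N : ℕ} (hN : N ≠ 0) (y₁ y₂ : ℕ) :
    N.divisors.filter (fun e => y₁ < e ∧ e ≤ y₂) = (Ioc y₁ y₂).filter (fun e => e ∣ N) := by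
  ext e
  simp only [mem_filter, Nat.mem_divisors, mem_Ioc]
  constructor
  · rintro ⟨⟨hd, -⟩, h1, h2⟩
    exact ⟨⟨h1, h2⟩, hd⟩
  · rintro ⟨⟨h1, h2⟩, hd⟩
    exact ⟨⟨hd, hN⟩, h1, h2⟩

/-- **Fubini**: `W_g(x; y₁, y₂) = ∑_{y₁<e≤y₂} #{1 ≤ n ≤ x : e ∣ g(n)}` when `g` has no zero in `[1, x]`. [folklore] -/
theorem polyWindowRootCount_eq_sum_card (g : ℤ[X]) {x : ℕ} (hg0 : ∀ n ∈ Icc 1 x, g.eval (n : ℤ) ≠ 0)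
    (y₁ y₂ : ℕ) :
    polyWindowRootCount g x y₁ y₂
      = ∑ e ∈ Ioc y₁ y₂, #((Icc 1 x).filter fun n : ℕ => (e : ℤ) ∣ g.eval (n : ℤ)) := by
  unfold polyWindowRootCount
  have h1 : ∀ n ∈ Icc 1 x, #(((g.eval (n : ℤ)).natAbs.divisors).filter fun e => y₁ < e ∧ e ≤ y₂)
      = ∑ e ∈ Ioc y₁ y₂, if (e : ℤ) ∣ g.eval (n : ℤ) then 1 else 0 := by
    intro n hn
    rw [divisors_filter_window_eq_Ioc_filter (Int.natAbs_ne_zero.mpr (hg0 n hn)), card_filter]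
    refine sum_congr rfl fun e _ => ?_
    simp only [Int.natCast_dvd]
  rw [sum_congr rfl h1, sum_comm]
  refine sum_congr rfl fun e _ => ?_
  rw [card_filter]

/-- For a modulus `e > x`, the `n ∈ [1, x]` with `e ∣ g(n)` ARE the roots of `g` modulo `e` lying in `[1, x]`
(each residue class has at most one representative in `[1, x]`). [folklore] -/
theorem Icc_filter_dvd_eq_rootResidues_inter (g : ℤ[X]) {x e : ℕ} (hxe : x < e) :
    (Icc 1 x).filter (fun n : ℕ => (e : ℤ) ∣ g.eval (n : ℤ)) = rootResidues g e ∩ Icc 1 x := by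
  ext n
  simp only [mem_filter, mem_inter, mem_rootResidues, mem_Icc]
  constructor
  · rintro ⟨⟨h1, h2⟩, hd⟩
    exact ⟨⟨by omega, hd⟩, h1, h2⟩
  · rintro ⟨⟨-, hd⟩, h1, h2⟩
    exact ⟨⟨h1, h2⟩, hd⟩

/-- Past `x` the window root count is a sum of located root counts:
`W_g(x; y₁, y₂) = ∑_{y₁<e≤y₂} #{ν ∈ [1, x] : g(ν) ≡ 0 (mod e)}` for `x ≤ y₁`. [this work] -/
theorem polyWindowRootCount_eq_sum_card_rootResidues (g : ℤ[X]) {x y₁ : ℕ}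
    (hg0 : ∀ n ∈ Icc 1 x, g.eval (n : ℤ) ≠ 0) (hxy : x ≤ y₁) (y₂ : ℕ) :
    polyWindowRootCount g x y₁ y₂ = ∑ e ∈ Ioc y₁ y₂, #(rootResidues g e ∩ Icc 1 x) := by
  rw [polyWindowRootCount_eq_sum_card g hg0]
  refine sum_congr rfl fun e he => ?_
  rw [Icc_filter_dvd_eq_rootResidues_inter g (hxy.trans_lt (mem_Ioc.mp he).1)]

/-- The window heuristic is `∑_{y₁<e≤y₂} x·ρ_g(e)/e`. [this work] -/
theorem polyWindowHeuristic_eq_sum (g : ℤ[X]) (x y₁ y₂ : ℕ) :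
    polyWindowHeuristic g x y₁ y₂ = ∑ e ∈ Ioc y₁ y₂, (x : ℝ) * polyRootCountMod ![g] e / e := by
  unfold polyWindowHeuristic
  rw [sum_const, Nat.card_Icc, Nat.add_sub_cancel, nsmul_eq_mul, mul_sum]
  refine sum_congr rfl fun e _ => ?_
  ring

/-- **EXACT IDENTITY — the window root discrepancy is a bilinear form in Hooley sums**: for `x ≤ y₁` and `g`
without zeros in `[1, x]`,
`W_g(x; y₁, y₂) − x·∑_{y₁<e≤y₂} ρ_g(e)/e = ∑_{y₁<e≤y₂} (1/e)·∑_{0<h<e} F_{[1,x]}(h; e)·S_g(h; e)`. [this work] -/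
theorem polyWindowRootCount_sub_heuristic_eq (g : ℤ[X]) {x y₁ : ℕ}
    (hg0 : ∀ n ∈ Icc 1 x, g.eval (n : ℤ) ≠ 0) (hxy : x ≤ y₁) (y₂ : ℕ) :
    ((polyWindowRootCount g x y₁ y₂ : ℝ) : ℂ) - ((polyWindowHeuristic g x y₁ y₂ : ℝ) : ℂ)
      = ∑ e ∈ Ioc y₁ y₂, (1 / (e : ℂ)) * ∑ h ∈ Ico 1 e, intervalKernel e 1 x h * hooleySum g e h := by
  rw [polyWindowRootCount_eq_sum_card_rootResidues g hg0 hxy, polyWindowHeuristic_eq_sum]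
  push_cast
  rw [← sum_sub_distrib]
  refine sum_congr rfl fun e he => ?_
  have hxe : x < e := hxy.trans_lt (mem_Ioc.mp he).1
  have he0 : (e : ℂ) ≠ 0 := by exact_mod_cast (show e ≠ 0 by omega)
  rw [← card_rootResidues_inter_Icc_mul_sub_eq g (a := 1) hxe, Nat.add_sub_cancel]
  field_simp

/-- **THE WINDOW COMPLETION INEQUALITY**: for `x ≤ y₁` and `g` without zeros in `[1, x]`,
`|W_g(x; y₁, y₂) − x·∑_{y₁<e≤y₂} ρ_g(e)/e| ≤ ∑_{y₁<e≤y₂} (1/e)·∑_{0<h<e} min(x, e/(2 min(h, e−h)))·|S_g(h; e)|`.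
[this work] -/
theorem abs_polyWindowRootCount_sub_heuristic_le (g : ℤ[X]) {x y₁ : ℕ}
    (hg0 : ∀ n ∈ Icc 1 x, g.eval (n : ℤ) ≠ 0) (hxy : x ≤ y₁) (y₂ : ℕ) :
    |(polyWindowRootCount g x y₁ y₂ : ℝ) - polyWindowHeuristic g x y₁ y₂|
      ≤ ∑ e ∈ Ioc y₁ y₂, (1 / (e : ℝ)) * ∑ h ∈ Ico 1 e,
          min (x : ℝ) ((e : ℝ) / (2 * ((min h (e - h) : ℕ) : ℝ))) * ‖hooleySum g e h‖ := by
  rw [polyWindowRootCount_eq_sum_card_rootResidues g hg0 hxy, polyWindowHeuristic_eq_sum, Nat.cast_sum,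
    ← sum_sub_distrib]
  refine (abs_sum_le_sum_abs _ _).trans (sum_le_sum fun e he => ?_)
  have hxe : x < e := hxy.trans_lt (mem_Ioc.mp he).1
  have := abs_card_rootResidues_inter_Icc_sub_le g (a := 1) hxe
  rw [Nat.add_sub_cancel] at this
  exact this

/-! ### The located root count `Mid_g(x)`: `n`-dependent windows -/

/-- The `n ≤ x` whose value admits located divisors of size `e`: `B_g(x; e) = {1 ≤ n ≤ x : e² < |g(n)|}`. [this work] -/
def polyLocatedRange (g : ℤ[X]) (x e : ℕ) : Finset ℕ :=
  (Icc 1 x).filter fun n => e * e < (g.eval (n : ℤ)).natAbs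

/-- `B_g(x; e) ⊆ [1, x]`. [this work] -/
theorem polyLocatedRange_subset (g : ℤ[X]) (x e : ℕ) : polyLocatedRange g x e ⊆ Icc 1 x :=
  filter_subset _ _

/-- The SHARP CRT HEURISTIC for `Mid_g`: `H⁻_g(x) = ∑_{1≤n≤x} ∑_{x<e, e²<|g(n)|} ρ_g(e)/e` (the heuristic
`polyLocatedHeuristic` uses `e² ≤ |g(n)|`; the two differ by at most `x`, `polyLocatedHeuristic_sub_sharp`). [this work] -/
noncomputable def polyLocatedHeuristicSharp (g : ℤ[X]) (x : ℕ) : ℝ :=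
  ∑ n ∈ Icc 1 x, ∑ e ∈ (Ioc x (Nat.sqrt (g.eval (n : ℤ)).natAbs)).filter
      (fun e => e * e < (g.eval (n : ℤ)).natAbs), (polyRootCountMod ![g] e : ℝ) / e

/-- `0 ≤ H_g(x) − H⁻_g(x) ≤ x`: per `n` the two windows differ only in `e = √|g(n)|` (when `|g(n)|` is a square),
a term `ρ_g(e)/e ≤ 1`. [this work] -/
theorem polyLocatedHeuristic_sub_sharp (g : ℤ[X]) (x : ℕ) :
    0 ≤ polyLocatedHeuristic g x - polyLocatedHeuristicSharp g x
      ∧ polyLocatedHeuristic g x - polyLocatedHeuristicSharp g x ≤ x := by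
  unfold polyLocatedHeuristic polyLocatedHeuristicSharp
  rw [← sum_sub_distrib]
  have hterm : ∀ n ∈ Icc 1 x,
      0 ≤ (∑ e ∈ Ioc x (Nat.sqrt (g.eval (n : ℤ)).natAbs), (polyRootCountMod ![g] e : ℝ) / e
          - ∑ e ∈ (Ioc x (Nat.sqrt (g.eval (n : ℤ)).natAbs)).filter
              (fun e => e * e < (g.eval (n : ℤ)).natAbs), (polyRootCountMod ![g] e : ℝ) / e)
      ∧ (∑ e ∈ Ioc x (Nat.sqrt (g.eval (n : ℤ)).natAbs), (polyRootCountMod ![g] e : ℝ) / e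
          - ∑ e ∈ (Ioc x (Nat.sqrt (g.eval (n : ℤ)).natAbs)).filter
              (fun e => e * e < (g.eval (n : ℤ)).natAbs), (polyRootCountMod ![g] e : ℝ) / e) ≤ 1 := by
    intro n _
    set N := (g.eval (n : ℤ)).natAbs with hN
    set S := Ioc x (Nat.sqrt N) with hS
    rw [← Finset.sum_filter_add_sum_filter_not S (fun e => e * e < N), add_sub_cancel_left]
    have hsub : S.filter (fun e => ¬ e * e < N) ⊆ {Nat.sqrt N} := by
      intro e he
      rw [mem_filter, hS, mem_Ioc] at he
      rw [mem_singleton]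
      have h1 : e * e ≤ N := Nat.le_sqrt.mp he.1.2
      have h2 : N ≤ e * e := not_lt.mp he.2
      have h3 : e * e = N := le_antisymm h1 h2
      rw [← h3, Nat.sqrt_eq]
    have hnn : ∀ e ∈ S.filter (fun e => ¬ e * e < N), (0 : ℝ) ≤ (polyRootCountMod ![g] e : ℝ) / e :=
      fun e _ => by positivity
    refine ⟨sum_nonneg hnn, ?_⟩
    calc ∑ e ∈ S.filter (fun e => ¬ e * e < N), (polyRootCountMod ![g] e : ℝ) / e
        ≤ ∑ e ∈ {Nat.sqrt N}, (polyRootCountMod ![g] e : ℝ) / e :=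
          sum_le_sum_of_subset_of_nonneg hsub fun e _ _ => by positivity
      _ = (polyRootCountMod ![g] (Nat.sqrt N) : ℝ) / Nat.sqrt N := sum_singleton _ _
      _ ≤ 1 := by
          rcases Nat.eq_zero_or_pos (Nat.sqrt N) with h0 | hpos
          · rw [h0, Nat.cast_zero, div_zero]; exact zero_le_one
          · rw [div_le_one (by exact_mod_cast hpos)]
            exact_mod_cast Literature.NumberTheory.Sieve.polyRootCountMod_le ![g] (Nat.sqrt N)
  refine ⟨sum_nonneg fun n hn => (hterm n hn).1, ?_⟩
  calc ∑ n ∈ Icc 1 x, _ ≤ ∑ _n ∈ Icc 1 x, (1 : ℝ) := sum_le_sum fun n hn => (hterm n hn).2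
    _ = x := by rw [sum_const, Nat.card_Icc, Nat.add_sub_cancel, nsmul_eq_mul, mul_one]

/-- **Fubini for the located root count**: `Mid_g(x) = ∑_{x<e≤E} #(roots of g mod e in B_g(x; e))` for every
`E` with `|g(n)| ≤ E` on `[1, x]` (all located divisors are `≤ E`). [this work] -/
theorem polyLocatedRootCount_eq_sum_card (g : ℤ[X]) {x E : ℕ} (hg0 : ∀ n ∈ Icc 1 x, g.eval (n : ℤ) ≠ 0)
    (hE : ∀ n ∈ Icc 1 x, (g.eval (n : ℤ)).natAbs ≤ E) :
    polyLocatedRootCount g x = ∑ e ∈ Ioc x E, #(rootResidues g e ∩ polyLocatedRange g x e) := by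
  unfold polyLocatedRootCount
  have h1 : ∀ n ∈ Icc 1 x,
      #(((g.eval (n : ℤ)).natAbs.divisors).filter fun e => x < e ∧ e * e < (g.eval (n : ℤ)).natAbs)
        = ∑ e ∈ Ioc x E, if (e : ℤ) ∣ g.eval (n : ℤ) ∧ e * e < (g.eval (n : ℤ)).natAbs then 1 else 0 := by
    intro n hn
    have hN := Int.natAbs_ne_zero.mpr (hg0 n hn)
    rw [← card_filter]
    congr 1
    ext e
    simp only [mem_filter, Nat.mem_divisors, mem_Ioc, Int.natCast_dvd]
    constructor
    · rintro ⟨⟨hd, -⟩, h1, h2⟩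
      exact ⟨⟨h1, (Nat.le_of_dvd (Nat.pos_of_ne_zero hN) hd).trans (hE n hn)⟩, hd, h2⟩
    · rintro ⟨⟨h1, -⟩, hd, h2⟩
      exact ⟨⟨hd, hN⟩, h1, h2⟩
  rw [sum_congr rfl h1, sum_comm]
  refine sum_congr rfl fun e he => ?_
  rw [← card_filter]
  congr 1
  ext n
  have hxe : x < e := (mem_Ioc.mp he).1
  simp only [mem_filter, mem_inter, mem_rootResidues, polyLocatedRange, mem_Icc]
  constructor
  · rintro ⟨⟨h1, h2⟩, hd, h3⟩
    exact ⟨⟨by omega, hd⟩, ⟨h1, h2⟩, h3⟩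
  · rintro ⟨⟨-, hd⟩, ⟨h1, h2⟩, h3⟩
    exact ⟨⟨h1, h2⟩, hd, h3⟩

/-- **Fubini for the sharp heuristic**: `H⁻_g(x) = ∑_{x<e≤E} #B_g(x; e)·ρ_g(e)/e` for the same `E`. [this work] -/
theorem polyLocatedHeuristicSharp_eq_sum (g : ℤ[X]) {x E : ℕ}
    (hE : ∀ n ∈ Icc 1 x, (g.eval (n : ℤ)).natAbs ≤ E) :
    polyLocatedHeuristicSharp g x
      = ∑ e ∈ Ioc x E, (#(polyLocatedRange g x e) : ℝ) * polyRootCountMod ![g] e / e := by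
  unfold polyLocatedHeuristicSharp
  have h1 : ∀ n ∈ Icc 1 x,
      ∑ e ∈ (Ioc x (Nat.sqrt (g.eval (n : ℤ)).natAbs)).filter (fun e => e * e < (g.eval (n : ℤ)).natAbs),
          (polyRootCountMod ![g] e : ℝ) / e
        = ∑ e ∈ Ioc x E, if e * e < (g.eval (n : ℤ)).natAbs then (polyRootCountMod ![g] e : ℝ) / e else 0 := by
    intro n hn
    rw [← sum_filter]
    congr 1
    ext e
    simp only [mem_filter, mem_Ioc]
    constructor
    · rintro ⟨⟨h1, -⟩, h3⟩
      refine ⟨⟨h1, ?_⟩, h3⟩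
      have : e ≤ e * e := Nat.le_mul_self e
      exact (this.trans h3.le).trans (hE n hn)
    · rintro ⟨⟨h1, -⟩, h3⟩
      exact ⟨⟨h1, Nat.le_sqrt.mpr h3.le⟩, h3⟩
  rw [sum_congr rfl h1, sum_comm]
  refine sum_congr rfl fun e _ => ?_
  rw [← sum_filter]
  simp only [polyLocatedRange, sum_const, nsmul_eq_mul]
  ring

/-- **EXACT IDENTITY FOR THE LOCATED ROOT COUNT**: for `g` without zeros in `[1, x]` and any `E ≥ max_{n≤x}|g(n)|`,
`Mid_g(x) − H⁻_g(x) = ∑_{x<e≤E} (1/e)·∑_{0<h<e} F_{B_g(x;e)}(h; e)·S_g(h; e)`,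
`F_B(h; e) = ∑_{m∈B} e(−hm/e)`: the open quantity of the `d ≥ 3` rung (`WindowRootEquidistribution g`, i.e.
`Mid_g − H_g = o(x log x)`) is EXACTLY a bilinear form in Hooley's exponential sums over the roots of `g` to the
moduli `e ∈ (x, x^{d/2+o(1)}]`, with the Fourier coefficients of the sets `B_g(x; e) ⊆ [1, x]` as weights. [this work] -/
theorem polyLocatedRootCount_sub_sharp_eq (g : ℤ[X]) {x E : ℕ} (hg0 : ∀ n ∈ Icc 1 x, g.eval (n : ℤ) ≠ 0)
    (hE : ∀ n ∈ Icc 1 x, (g.eval (n : ℤ)).natAbs ≤ E) :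
    ((polyLocatedRootCount g x : ℝ) : ℂ) - ((polyLocatedHeuristicSharp g x : ℝ) : ℂ)
      = ∑ e ∈ Ioc x E, (1 / (e : ℂ)) * ∑ h ∈ Ico 1 e,
          (∑ m ∈ polyLocatedRange g x e, eAdd e (-(h * m))) * hooleySum g e h := by
  rw [polyLocatedRootCount_eq_sum_card g hg0 hE, polyLocatedHeuristicSharp_eq_sum g hE]
  push_cast
  rw [← sum_sub_distrib]
  refine sum_congr rfl fun e he => ?_
  have hxe : x < e := (mem_Ioc.mp he).1
  have he0' : 0 < e := by omega
  have he0 : (e : ℂ) ≠ 0 := by exact_mod_cast he0'.ne'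
  have hB : ∀ m ∈ polyLocatedRange g x e, m < e := fun m hm =>
    (mem_Icc.mp (polyLocatedRange_subset g x e hm)).2.trans_lt hxe
  have hid := sum_kernel_mul_charSum_eq_card_inter (rootResidues_lt g e) hB
  rw [range_eq_Ico, sum_eq_sum_Ico_succ_bot he0'] at hid
  simp only [Nat.cast_zero, zero_mul, neg_zero, eAdd_zero, sum_const, nsmul_eq_mul, mul_one,
    card_rootResidues] at hid
  have hid' : ∑ h ∈ Ico 1 e, (∑ m ∈ polyLocatedRange g x e, eAdd e (-(h * m))) * hooleySum g e h
      = (e : ℂ) * #(rootResidues g e ∩ polyLocatedRange g x e)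
        - (#(polyLocatedRange g x e) : ℂ) * polyRootCountMod ![g] e := by
    rw [← hid]
    unfold hooleySum
    ring
  rw [hid']
  field_simp

/-- **The located completion inequality**: with the trivial kernel bound `|F_B(h; e)| ≤ #B ≤ x` replaced by nothing
better, `|Mid_g(x) − H⁻_g(x)| ≤ ∑_{x<e≤E} (1/e)·∑_{0<h<e} |F_{B_g(x;e)}(h; e)|·|S_g(h; e)|`. [this work] -/
theorem abs_polyLocatedRootCount_sub_sharp_le (g : ℤ[X]) {x E : ℕ} (hg0 : ∀ n ∈ Icc 1 x, g.eval (n : ℤ) ≠ 0)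
    (hE : ∀ n ∈ Icc 1 x, (g.eval (n : ℤ)).natAbs ≤ E) :
    |(polyLocatedRootCount g x : ℝ) - polyLocatedHeuristicSharp g x|
      ≤ ∑ e ∈ Ioc x E, (1 / (e : ℝ)) * ∑ h ∈ Ico 1 e,
          ‖∑ m ∈ polyLocatedRange g x e, eAdd e (-(h * m))‖ * ‖hooleySum g e h‖ := by
  have hid := polyLocatedRootCount_sub_sharp_eq g hg0 hE
  have hn : |(polyLocatedRootCount g x : ℝ) - polyLocatedHeuristicSharp g x|
      = ‖((polyLocatedRootCount g x : ℝ) : ℂ) - ((polyLocatedHeuristicSharp g x : ℝ) : ℂ)‖ := by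
    rw [← Complex.ofReal_sub, Complex.norm_real, Real.norm_eq_abs]
  rw [hn, hid]
  refine (norm_sum_le _ _).trans (sum_le_sum fun e he => ?_)
  have he0 : 0 < e := by have := (mem_Ioc.mp he).1; omega
  rw [norm_mul, norm_div, norm_one, Complex.norm_natCast]
  refine mul_le_mul_of_nonneg_left ?_ (by positivity)
  refine (norm_sum_le _ _).trans (sum_le_sum fun h _ => ?_)
  rw [norm_mul]

end Summit.Parity.BatemanHorn.Theorems
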